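import Literature.NumberTheory.EllipticCurves.BurungaleSkinnerTianWan2024.SupersingularPPartOPEN
import Literature.NumberTheory.EllipticCurves.QuadraticTwist
import HarnessLib

/-!
# Burungale–Skinner–Tian–Wan (arXiv:2409.01350v2, PREPRINT), Thm. 1.5, TWIST CLAUSE: the ANNOUNCED
# `p`-part of BSD at a supersingular prime for the quadratic twists `E^K` of a semistable `E`
# (`disc K` coprime to `Np`, divisible only by ordinary primes of `E`) — as an explicitly labelled
# OPEN hypothesis, and the conditional theorem for this sub-family of class X7

HONEST FRAMING (cell `b2b-bsdres`, run/shared/lean/b2b/bsd-rank1-residual/; supersingular family,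
prover B = unit `b2b-bsdres-additive-p3`, gen 16; CLASS-CLOSURE lane §3.11, experiment type E2
"obstruction anatomy → sub-partition": the VERBATIM-EXTENSION sub-class of X7): prove what is
provable now; no claim beyond stated classes. An ANNOUNCED preprint enters only as an explicitly
labelled OPEN hypothesis, NEVER as a theorem; construction-shaped classes are typed, not attempted;
this is not "finishing BSD". Nothing is asserted: ONE `def … : Prop` (OPEN, never to be fed as a
theorem) and theorems taking it as an explicit binder; class X7 stays CONSTRUCTION-SHAPED; nothing
is booked.

The sibling file `SupersingularPPartOPEN.lean` (harvest seat 1) types Thm. 1.5 for the semistable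
curve itself (class X6) and leaves its twist clause as `TODO(general form)`: "the twist clause
'E^K, disc(K) coprime to Np, only ordinary primes of E dividing disc(K)' — an announced
sub-population of class X7 — once needed". The CLASS-CLOSURE plan (HOME/CLASS-CLOSURE-PLAN.md §3.11)
now needs it: it is exactly the sub-class of X7 (`GoodSS ∧ ¬Semistable`) on which the announced
argument extends VERBATIM — counted by rmap-2 GEN 4 (kit j112050): 64 (r = 0) ‖ 248 (r = 1) + 2
(tail) = 314 S-b pairs of the 7 210 X7/X7T residue pairs (4.4 %).

Source (read: `paper:arxiv-2409.01350` chunks p0003–p0006 = printed pp. 3–6 of arXiv v2, 2024-09-11 —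
Thm. 1.3 p. 3, Thm. 1.5 p. 4, §1.2.1 display (1.7) `a_p(E) = 0` p. 6, whose label the held TeX text
prints as "(h4)" and the PDF as "(1.7)"; lit FRESHNESS 2026-08-21: still no journal version),
verbatim — Thm. 1.3: "… Moreover, the same holds for any
quadratic twist `E^K := E ⊗ χ_K` for `χ_K` the character associated to a quadratic field extension
`K/ℚ` with discriminant coprime to `Np` and divisible only by primes of ordinary reduction for `E`."
Thm. 1.5: "Let `E/ℚ` be a semistable elliptic curve, and `p > 2` a supersingular prime. If `p = 3`,
suppose that (1.7) holds. If `ord_{s=1} L(s, E/ℚ) = r ≤ 1`, then the `p`-part of the BSD formula is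
true, i.e. `|L^{(r)}(1, E/ℚ)/(Ω_E R(E/ℚ))|_p^{−1} = |#Ш(E/ℚ) · ∏_{q∣N} c_q(E/ℚ)|_p^{−1}` … Moreover,
the same holds for any quadratic twist `E^K` as in Theorem 1.3."

Transcription (tree dictionary of the sibling file; the only new item is the twist datum):
`W₀` = a globally minimal model of the semistable curve `E` (`Semistable W₀`, `p ≠ 2`, `GoodSS W₀ p`,
`p = 3 → a_3(W₀) = 0`); `K = ℚ(√d)` for a square-free integer `d ≠ 1`; a prime `q` is RAMIFIED in
`K` iff `q ∣ d`, or `q = 2` and `d ≢ 1 (mod 4)` (the primes dividing `disc K ∈ {d, 4d}`);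
"`disc K` coprime to `Np` and divisible only by primes of ordinary reduction for `E`" = every
ramified `q` satisfies `q ≠ p` and `GoodOrd W₀ q` (good — hence `q ∤ N` — and `q ∤ a_q`);
`E^K` = the twist by `d` (= by `disc K` up to the square `4`): `W` a globally minimal model with
`C • W = W₀.quadraticTwist d` (`WeierstrassCurve.quadraticTwist`; the shape used by the tree's
`frobeniusTrace_quadraticTwist`); conclusion for `W` in analytic rank `≤ 1` = the cell's NO-TORSION
print shape at `p` (hypothesis of `Rank1Residual.bsdp_of_padicVal_printShape`), exactly as in the
sibling's `thm15_pPart_OPEN`. NEVER cite the `Prop` as a theorem.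

Then `bsdp_of_thm15_twist_OPEN`: granted the OPEN binder, GZK and `Irr W p`, `BSD(W, p)` at every
such twist in analytic rank `≤ 1` (the bridge `bsdp_of_padicVal_printShape`). The binder `Irr W p`
and the membership `GoodSS W p` / `W ∈ X7` are automatic (good supersingular reduction passes to a
twist unramified at `p`; Serre 1972 Prop. 12) but their proofs live on the Summits side
(`Summits/…/Supersingular/TwistStability.lean`, `Rank1Residual.ClassX7.irr`), so they are kept as
hypotheses here and discharged in the Summits companion `Supersingular/X7TwistClauseOPEN.lean`.
STATUS of the binder: PRE (announced 2024, unrefereed). Conditional; closes nothing.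

## Litref D-audit of record (cell `pub/bsd-litref`, tranche T2b, 2026-08-26)

Reading of record `pub/bsd-litref/bstw24/sheets/D-AUDIT-bstw24-r1.md` sha16 2ab68891cb7b08bc (reader 1, FROZEN), verdict
O2 on THIS binder: **VERBATIM / weaker than print** — the BODY form Cor. 10.2 (TeX l.7328–7342 of the v2 source
5926f035551c636d, printed pp. 86–87) prints the twist clause (l.7341) as «quadratic field extensions K/ℚ with
discriminant coprime to Np», with NO ordinarity proviso (likewise Thm. 10.1 p. 86, Thm. 10.5 p. 87, Thm. 9.24 p. 85);
the INTRO's Thm. 1.3 / 1.5 (pp. 3–4) add «and divisible only by primes of ordinary reduction for E». This binder types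
the intro's NARROWER clause, hence asserts LESS than the body print (the safe reading; whether the proviso is intended
or vestigial is an open reading question — `pub/bsd-littype/OPEN-QUESTIONS-01.md` Q4; it reappears as hypothesis (vi) of
Thm. 10.12, p. 89, where it is needed). No torsion term on either side (E[p] is irreducible at a supersingular p > 2).
Proof-chain status (r1 O5 / O6, for the record, not a property of the statement): at p = 3 GAP(line) — Thm. 4.1 note TeX
l.2915 (p. 34) + Rem. 6.1 l.4918–4922 (p. 58) ⇐ [SV-S-Ohta] (unpublished, unlocated 2026-08-26); at p ≥ 5 PASS-in-cell
WITH THE bsd-ssimc CELL REPAIRS (re-verified first-hand, ADDENDUM-2 5fc2aa1cce88a1ac + ADDENDUM-3 f18da4daf35aa2e0;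
ADDENDUM-4 14b633e2f406b0ef changes no verdict kind), print gapped-as-printed at the §6 normalisation and at Thm. 9.24's
proof l.7275–7286 (ADDENDUM-1 dd57a5d99fb5bd7f); Thm. 9.24's twist case «essentially the same argument applies»
(l.7282–7285) is a not-written step (not needed untwisted; it IS the step this twist binder would need). Reader 2
(INDEPENDENT; `D-AUDIT-bstw24-r2.md` 69e4de3690fd21dc + addenda 1–6, N2; ADDENDUM-4 f739c7b8993da616 re-derives the
supersingular §6.2 normalisation constant p/(2(p+1)λ_N(g)) independently of reader 1 — CONCUR): this binder VERBATIM
with a weaker-than-print twist clause (intro wording [tex L444–446] has MORE hypotheses than the body's Thm. 10.1 / Cor.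
10.2 [tex L7315–7341]) — concurring. BY-NAME NEIGHBOURS: the BODY form of this clause is typed SEPARATELY as
`cor102_twist_pPart_OPEN` (sibling file `QuadraticTwistPPartOPEN.lean`, with the PROVED bridge
`thm15_twist_of_cor102_twist_OPEN` body ⟹ intro — the intro/body split is kept split in the tree, never averaged); and,
for r = 0 in refereed print,
`Literature.NumberTheory.EllipticCurves.JetchevSkinnerWan2017.thm721iii_twist_padicValRat_bsd_rank_zero_OPEN` (p459674;
JSW Thm. 7.2.1 (iii) + Rem. 7.2.2 for `E^{D″}`, `(D″, Np) = 1`, NO ordinarity proviso — the body-form r = 0 sentence,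
itself resting on the withdrawn [W] and hence on this preprint, Rem. 10.3 (ii)). Referee desks on this reading (D-audit
desk = referee C4 `pub-bsdpct-r7` since 2026-08-26T22:54Z (litref wakes MOVED r3 → r7, one family per round;
director-bsd 22:55:33Z), before that referee C `pub-bsdpct-r3` (from 19:21Z) and C2 `pub-bsdpct-r4`; wakes
bstw24-r1-2ab68891… + addenda 1–5 / -r2-69e4de36… + addenda 1–6): referee C ROUND 353 (δ) (2026-08-26T20:27:48Z, jsw17
group) already words the twist clause — intro [p0004:L90–L91] vs body [p0075:L18/L42/L115] «inconsistency REAL on my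
copy», proof «by assertion» [p0074:L14–L17], GAP(line) worded `JSW17-7.2.1(iii)-twist@BSTW-III-2.2(unrefereed,
intro/body-inconsistent)` (prices nothing today; «the intro/body split is faithfully SPLIT in the tree, not averaged»);
referee C4's bstw24 family round: ROUND C4-R3 (2026-08-27T00:54:31Z, referee C4 pub-bsdpct-r7; one slot, 12 wakes: r1
2ab68891 + ADD-1…5, r2 69e4de36 + ADD-1…5; r2 ADD-6 eaa05811 to be graded as a rider): (α) statement audits «thm13_OPEN
and thm15_pPart_OPEN VERBATIM; the X7-twist and thm15-twist binders WEAKER-than-print (intro wording; safe direction) …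
PASS ×2 CONCUR» — no RETURN(line) or SMUGGLED(line) ⇒ 0 binder fixes; (β) §5 @ p = 3 «GAP(line), VERDICT OF RECORD»
(l.2915 + l.4918–4923; strike rule = G♭ ∧ G♯^{Eis} ∧ l.4175–4176 at 3; «all A10 T-EISRG3C cells STAY LITERAL … 0 move»;
«Same wall governs K3 W1 @3»); (γ) §5 @ p ≥ 5 «PASS-in-cell MODULO PUB inputs, VERDICT OF RECORD», riders (R-a), (R-b),
l.4175–4176 on (anom); (δ) l.4175–4176 printed-unproved CONFIRMED, Lemma W admission HELD OPEN; (ε) Q1 «INCOMPLETE AS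
WORDED», Prop. 4.12 holds via r1 ADD-5 Lemma S + T «VERIFIED AT THIS DESK» ⇒ «PASS-in-cell WITH READER REPAIR»,
disagreement «DISSOLVED BY CONCESSION»; (ζ) O6, O7 @ p ≥ 5 «PASS-in-cell WITH CELL REPAIRS, CONCUR ×2»; 0 cells move;
referee A: not seized of a docstring-bearing word on this paper — GAP(line) @ 3 ⇒ 0 move (A10 register: 32
T-EISRG3C keys at the lead-B count, 31 at the A fold, CONFIRMED-as-flag register-wide: referee C R353 (ζ), R361 (ε), A
R376.4); C4-R3 (θ) opens the pricing gate — the PRICING-A10-TEISRG3C record of bsd-litref-bstw24-pv goes to A, and its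
eventual word rides the next substantive edit of this file (cell ruling 2026-08-26T21:02:36Z). The statement below is
UNCHANGED by the litref pass (typer `bsd-litref-bstw24-ty`).

## References
* [BurungaleSkinnerTianWan2024] arXiv:2409.01350v2, Thm. 1.3 (twist clause, p. 3), Thm. 1.5 (p. 4), Rem. 1.4,
  §1.2.1 (1.7) (p. 6; TeX label (h4)).
* [JetchevSkinnerWan2017] Camb. J. Math. 5 (2017) Thm. 7.2.1 (iii) (the r = 0 twist sentence in print, itself resting on the withdrawn [W]).
* RESIDUAL-MAP.md §B CENSUS SUPPLEMENT (rmap-2 GEN 4, kit j112050): JSW-shape 82 ‖ 333 + 5, BSTW-shape 64 ‖ 248 + 2 S-b pairs.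
-/

set_option autoImplicit false

noncomputable section

open scoped Classical

open WeierstrassCurve Literature.NumberTheory.EllipticCurves
  Literature.NumberTheory.EllipticCurves.Rank1Residual

namespace Literature.NumberTheory.EllipticCurves.BurungaleSkinnerTianWan2024

/-- `q` is ramified in `ℚ(√d)` (`d` square-free, `d ≠ 1`): `q ∣ d`, or `q = 2` and `d ≢ 1 (mod 4)`
— i.e. `q` divides the discriminant `d` resp. `4d` of `ℚ(√d)`. Transcription helper for the twist
clause ("discriminant coprime to `Np` and divisible only by primes of ordinary reduction").
[cite: BurungaleSkinnerTianWan2024, Thm. 1.3 (twist clause; shape only, nothing asserted)] -/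
def RamifiedInQuadratic (d : ℤ) (q : ℕ) : Prop := (q : ℤ) ∣ d ∨ (q = 2 ∧ d % 4 ≠ 1)

/-- **OPEN HYPOTHESIS — UNREFEREED PREPRINT (arXiv:2409.01350v2, 2024), Thm. 1.5, twist clause.**
"Let `E/ℚ` be a semistable elliptic curve, and `p > 2` a supersingular prime. If `p = 3`, suppose
that (1.7) [`a_3 = 0`] holds. If `ord_{s=1} L = r ≤ 1`, then the `p`-part of the BSD formula is true
… Moreover, the same holds for any quadratic twist `E^K := E ⊗ χ_K` for `χ_K` the character
associated to a quadratic field extension `K/ℚ` with discriminant coprime to `Np` and divisible only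
by primes of ordinary reduction for `E`." Transcribed: `W₀` globally minimal, `p ≠ 2`,
`Semistable W₀`, `GoodSS W₀ p`, `p = 3 → a_3(W₀) = 0`; `d` square-free, `d ≠ 1`, every prime
ramified in `ℚ(√d)` (`RamifiedInQuadratic d q`) is `≠ p` and good ORDINARY for `W₀` (`GoodOrd W₀ q`);
`W` globally minimal with `C • W = W₀.quadraticTwist d` (a model of `E^K`); `W.analyticRank ≤ 1`
⇒ the no-torsion print shape for `W` at `p` (`L^{(r)}(E^K,1)/(Ω·Reg) = q ∈ ℚ`,
`ord_p q = ord_p #Ш(E^K) + ord_p ∏ c_ℓ(E^K)`). NEVER cite this `Prop` as a theorem; take it as an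
explicit hypothesis (the announced discharge of the BSTW-twist-shape sub-family of class X7). Litref D-audit of
record (D-AUDIT-bstw24-r1 2ab68891cb7b08bc, O2; module docstring): VERBATIM / weaker than print — the body form
Cor. 10.2 (l.7341, p. 86) has the twist clause WITHOUT the ordinarity proviso typed here.
[claim: BurungaleSkinnerTianWan2024, status: under-review]
[cite: BurungaleSkinnerTianWan2024, Thm. 1.5 with Thm. 1.3 (twist clause; ANNOUNCED, typed as an OPEN hypothesis, nothing asserted)] -/
def thm15_twist_pPart_OPEN : Prop :=
  ∀ (W₀ W : WeierstrassCurve ℚ) [W₀.IsElliptic] [W₀.IsGloballyMinimal] [W.IsElliptic]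
    [W.IsGloballyMinimal] (p : ℕ) [Fact p.Prime] (d : ℤ) (C : VariableChange ℚ),
    p ≠ 2 → Semistable W₀ → GoodSS W₀ p → (p = 3 → W₀.frobeniusTrace 3 = 0) →
    Squarefree d → d ≠ 1 →
    (∀ (q : ℕ) [Fact q.Prime], RamifiedInQuadratic d q → q ≠ p ∧ GoodOrd W₀ q) →
    C • W = W₀.quadraticTwist (d : ℚ) →
    W.analyticRank ≤ 1 →
      ∃ r : ℚ, W.leadingLCoeff / ((W.realPeriodRat * W.regulator : ℝ) : ℂ) = (r : ℂ) ∧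
        padicValRat p r = (padicValNat p W.shaOrder : ℤ) + padicValNat p W.tamagawaProduct

/-- **The BSTW-twist-shape sub-family of X7, conditional theorem (announced discharge as an OPEN
binder).** IF the announced twist clause of Thm. 1.5 (`hBSTW_OPEN`, unrefereed) holds, then for
every semistable `W₀` with a supersingular prime `p > 2` (and `a_3 = 0` if `p = 3`), every
square-free `d ≠ 1` all of whose ramified primes are `≠ p` and good ordinary for `W₀`, and every
globally minimal model `W` of `W₀^{(d)}` with `E[p]` irreducible for `W` (`hirr`; automatic, see the
Summits companion) and analytic rank `≤ 1`: Miller's `BSD(W, p)` — via the cell's bridge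
`bsdp_of_padicVal_printShape` (GZK `hGZK`). CONDITIONAL; closes nothing; X7 stays
CONSTRUCTION-SHAPED. [claim: BurungaleSkinnerTianWan2024, status: under-review]
[cite: BurungaleSkinnerTianWan2024, Thm. 1.5 with Thm. 1.3 (twist clause; ANNOUNCED, OPEN binder)] [cite: Miller2011LMS, §1 and Def. 1.1] -/
theorem bsdp_of_thm15_twist_OPEN (hBSTW_OPEN : thm15_twist_pPart_OPEN)
    (hGZK : rank_eq_analyticRank_of_analyticRank_le_one)
    (W₀ W : WeierstrassCurve ℚ) [W₀.IsElliptic] [W₀.IsGloballyMinimal] [W.IsElliptic]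
    [W.IsGloballyMinimal] (p : ℕ) [Fact p.Prime] (hp : p ≠ 2) (hsst : Semistable W₀)
    (hss : GoodSS W₀ p) (h4 : p = 3 → W₀.frobeniusTrace 3 = 0) {d : ℤ} (hd : Squarefree d)
    (hd1 : d ≠ 1) (hram : ∀ (q : ℕ) [Fact q.Prime], RamifiedInQuadratic d q → q ≠ p ∧ GoodOrd W₀ q)
    {C : VariableChange ℚ} (hC : C • W = W₀.quadraticTwist (d : ℚ)) (hirr : Irr W p)
    (hr : W.analyticRank ≤ 1) : BSDp W p :=
  bsdp_of_padicVal_printShape W p hGZK hr hirr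
    (hBSTW_OPEN W₀ W p d C hp hsst hss h4 hd hd1 (fun q _ h ↦ hram q h) hC hr)

/-- The X6 curve `W₀` itself is the case excluded here (`d ≠ 1`); for it the sibling binder
`thm15_pPart_OPEN` applies. Bookkeeping: the twist clause's hypotheses force `p ∤ d` (the prime `p`
is supersingular for `W₀`, every ramified prime is ordinary), so `p ∤ 2d` — the shape in which the
tree's twist lemmas (`frobeniusTrace_quadraticTwist`, good reduction of the twist) are stated.
[cite: BurungaleSkinnerTianWan2024, Thm. 1.3 (twist clause; shape only, nothing asserted)] -/
theorem not_dvd_two_mul_of_twistClause {W₀ : WeierstrassCurve ℚ} [W₀.IsGloballyMinimal] {p : ℕ}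
    [Fact p.Prime] (hp : p ≠ 2) (hss : GoodSS W₀ p) {d : ℤ}
    (hram : ∀ (q : ℕ) [Fact q.Prime], RamifiedInQuadratic d q → q ≠ p ∧ GoodOrd W₀ q) :
    ¬ (p : ℤ) ∣ 2 * d := by
  intro h
  have hpP : p.Prime := Fact.out
  have hpZ : Prime (p : ℤ) := Nat.prime_iff_prime_int.mp hpP
  rcases hpZ.dvd_or_dvd h with h2 | hdvd
  · have : p ∣ 2 := by exact_mod_cast h2
    exact hp ((Nat.prime_dvd_prime_iff_eq hpP Nat.prime_two).mp this)
  · have hq := hram p (Or.inl hdvd)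
    exact hq.2.2 hss.2

end Literature.NumberTheory.EllipticCurves.BurungaleSkinnerTianWan2024

end
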